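import Summits.Ventures.Crystal3D.Theorems.StickyWulffConstantGenericWallFloorBarlowOneSidedTop
import Summits.Ventures.Crystal3D.Theorems.StickyWulffConstantGenericWallFloorBarlowTopFamilyApartTilt
import Summits.Ventures.Crystal3D.Theorems.StickyWulffConstantGenericWallFloorBarlowFamilyCountOneSidedTilt
import HarnessLib

/-!
# The STEERED TOP plate's zigzag family and window lines are paid, clause (ii) only (K1b / EDGE-ON option (ε), bricks 5a/5b-top)
# (lane T crux `TextureLiminfV5`, stmt-Ventures-23912, sub-crux EDGE-ON `stub_edgeOn`; HOME/wall-p2-g11/EPSILON-SIZING.md)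

HONEST FRAMING. Venture `Summits/Ventures/Crystal3D` (cell `crystal3d-full`), route `route-Ventures-StickyWulffConstant`, helper `--supports` the
law-v5 crux `TextureLiminfV5` (stmt-Ventures-23912), registered line `TexShadow` v8.3, open stub `stub_edgeOn` (K4).  Rung credit only; F-C1 not moved; NOT
the stub.  Inputs BY NAME: E1 (`hsE`, `hcert`), `DoubleStarCoaxialAt` / `CapPairCoaxial` (from `StarPairFar`).

Tilt ports of `barlowFamily_card_le_payers_oneSided_top` / `barlow_lineCount_le_payers_oneSided_top` (…BarlowOneSidedTop, K1a DOWN half): the top plate walks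
with a unit steering `z`, ‖z + e₃‖ ≤ 1/4, from a reference upper slot `v₂` steep FOR `z`, `∇`-cappers `bestCapper G₂ (L₂ e₃) z`, chain frames
`chainFrames z L₂ v₂` apart from plate 1's two lattices; window/payer data in `−e₃`-heights (`topFamily_spec_apart_tilt`); the count goes through
`walkerFamilies_card_le_payers_sep` with `z₁ = z` and the cell's `z`-height bound `2R₀ + (ρ + h + 2R₀)/4`, whence the fuel term `4(ρ + h + 2R₀)/3`.
* **`barlowFamily_card_le_payers_oneSided_top_tilt`** — `#T₂ ≤ Σ_PAY (12 − deg)`;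
* **`barlow_lineCount_le_payers_oneSided_top_tilt`** — `∃ T₂ ⊇ {top-plate lines with a vertex in the band [h+R₀+3, h+R₀+4] at lateral ≤ ρ − m}`, margin
  `m = 3 + 8(h + 4R₀) + 3/δ₂`.
WHAT THIS IS NOT: not lane T's `hlines` shape (next file); F-C1 not moved.
-/

noncomputable section

namespace Summit.Ventures.Crystal3D.Theorems

open Finset
open Literature.MathematicalPhysics.StatisticalMechanics
open Summit.Ventures.Crystal3D.Cruxes.TextureLiminf.TexShadow (stacking)
open scoped InnerProductSpace

variable {X : Finset (EuclideanSpace ℝ (Fin 3))}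

open scoped Classical in
/-- **The STEERED TOP plate's zigzag family is paid, under clause (ii) of `FramesApart` alone**: `#T₂ ≤ Σ_PAY (12 − deg)`. -/
theorem barlowFamily_card_le_payers_oneSided_top_tilt (hX : ∀ p ∈ X, ∀ q ∈ X, p ≠ q → 1 ≤ dist p q)
    {sE : EuclideanSpace ℝ (Fin 3)} (hsE : sE ∈ fccSlots) (hcert : ExactOnly 0 (fccSlots.filter fun w => 0 < ⟪w, sE⟫_ℝ))
    (hDS : ∀ F₁ F₂ : EuclideanSpace ℝ (Fin 3) ≃ₗᵢ[ℝ] EuclideanSpace ℝ (Fin 3), DoubleStarCoaxialAt F₁ F₂) (hCP : CapPairCoaxial)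
    -- the cell
    {σ₁ σ₂ : ℤ → ℤ} (hσ₁ : IsHaggSeq σ₁) (hσ₂ : IsHaggSeq σ₂)
    (L₁ L₂ : EuclideanSpace ℝ (Fin 3) ≃ₗᵢ[ℝ] EuclideanSpace ℝ (Fin 3)) (s₀ s₂ : EuclideanSpace ℝ (Fin 3))
    (R₀ h ρ : ℝ) (hR₀ : 6 ≤ R₀) (hh : 0 ≤ h) (hρ : 1 ≤ ρ) (P₁ P₂ : Finset (EuclideanSpace ℝ (Fin 3))) (hP₁X : P₁ ⊆ X) (hP₂X : P₂ ⊆ X)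
    (hcell : ∀ p ∈ X, -(2 * R₀) ≤ p 2 ∧ p 2 ≤ h + 2 * R₀ ∧ p 0 ^ 2 + p 1 ^ 2 ≤ ρ ^ 2)
    (hP₁ : ∀ p, p ∈ P₁ ↔ (p ∈ stacking L₁ s₀ σ₁ ∧ -(2 * R₀) ≤ p 2 ∧ p 2 ≤ -R₀ ∧ p 0 ^ 2 + p 1 ^ 2 ≤ ρ ^ 2))
    (hP₂ : ∀ p, p ∈ P₂ ↔ (p ∈ stacking L₂ s₂ σ₂ ∧ h + R₀ ≤ p 2 ∧ p 2 ≤ h + 2 * R₀ ∧ p 0 ^ 2 + p 1 ^ 2 ≤ ρ ^ 2))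
    -- the steering and the top walk data (window heights along −e₃)
    {z : EuclideanSpace ℝ (Fin 3)} (hz : ‖z‖ = 1) (hze : ‖z - (-EuclideanSpace.single (2 : Fin 3) (1 : ℝ))‖ ≤ 1 / 4)
    (v₂ : EuclideanSpace ℝ (Fin 3)) (canon₂ : ℤ → EuclideanSpace ℝ (Fin 3) → EuclideanSpace ℝ (Fin 3) × List WalkEntry)
    (ms₂ : ℤ → EuclideanSpace ℝ (Fin 3))
    (hv₂ : v₂ ∈ fccSlots) (hv₂2 : v₂ 2 = Real.sqrt (2 / 3))
    (hsteep₂ : Real.sqrt 2 / 2 ≤ ⟪L₂ v₂, z⟫_ℝ)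
    (hcanon₂₁ : ∀ m t, σ₂ (m - 1) = 1 → canon₂ m t = (t, [⟨L₂, v₂, 0⟩]))
    (hcanon₂₂ : ∀ m t, σ₂ (m - 1) = -1 → canon₂ m t =
      (t, [⟨twinFrame L₂ (L₂ (EuclideanSpace.single (2 : Fin 3) (1 : ℝ))),
            bestCapper (twinFrame L₂ (L₂ (EuclideanSpace.single (2 : Fin 3) (1 : ℝ)))) (L₂ (EuclideanSpace.single (2 : Fin 3) (1 : ℝ))) z,
            L₂ (EuclideanSpace.single (2 : Fin 3) (1 : ℝ))⟩, ⟨L₂, v₂, 0⟩]))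
    (hms₂₁ : ∀ m, σ₂ m = 1 → ms₂ m = v₂)
    (hms₂₂ : ∀ m, σ₂ m = -1 → ms₂ m =
      basalMirror (bestCapper (twinFrame L₂ (L₂ (EuclideanSpace.single (2 : Fin 3) (1 : ℝ)))) (L₂ (EuclideanSpace.single (2 : Fin 3) (1 : ℝ))) z))
    {δ₂ : ℝ} (hδ₂0 : 0 < δ₂) (hδ₂ : ∀ m, δ₂ ≤ ⟪L₂ (ms₂ m), -EuclideanSpace.single (2 : Fin 3) (1 : ℝ)⟫_ℝ)
    -- frames apart from the bottom plate (clause (ii) of `FramesApart`, for THIS family only)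
    (hapart₂ : ∀ F ∈ chainFrames z L₂ v₂,
      F '' fccStacking 1 (Real.sqrt (2 / 3)) ≠ L₁ '' fccStacking 1 (Real.sqrt (2 / 3)) ∧
      F '' fccStacking 1 (Real.sqrt (2 / 3)) ≠
        (twinFrame L₁ (L₁ (EuclideanSpace.single (2 : Fin 3) (1 : ℝ)))) '' fccStacking 1 (Real.sqrt (2 / 3)))
    -- the window family (heights along −e₃)
    (H₂ ρin : ℝ) (hH₂lo : -(h + 2 * R₀) + 2 ≤ H₂) (hH₂hi : H₂ ≤ -(h + R₀) - 3)
    (hρin₂ : ρin + 8 * (h + 4 * R₀) + ((-(h + R₀) - 2 - H₂) / δ₂ + 2) ≤ ρ - 1)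
    {ι₂ : Type*} (T₂ : Finset ι₂) (m₂ a₂ b₂ : ι₂ → ℤ)
    (hlow₂ : ∀ i ∈ T₂, H₂ ≤ ⟪L₂ (barlowPos 1 (Real.sqrt (2 / 3)) σ₂ (m₂ i) (a₂ i) (b₂ i)) + s₂, -EuclideanSpace.single (2 : Fin 3) (1 : ℝ)⟫_ℝ)
    (hpred₂ : ∀ i ∈ T₂, ⟪L₂ (barlowPos 1 (Real.sqrt (2 / 3)) σ₂ (m₂ i) (a₂ i) (b₂ i) - ms₂ (m₂ i - 1)) + s₂,
      -EuclideanSpace.single (2 : Fin 3) (1 : ℝ)⟫_ℝ < H₂)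
    (hinjT₂ : ∀ i ∈ T₂, ∀ j ∈ T₂,
      barlowPos 1 (Real.sqrt (2 / 3)) σ₂ (m₂ i) (a₂ i) (b₂ i) = barlowPos 1 (Real.sqrt (2 / 3)) σ₂ (m₂ j) (a₂ j) (b₂ j) → i = j)
    (hlat₂ : ∀ i ∈ T₂, Real.sqrt ((L₂ (barlowPos 1 (Real.sqrt (2 / 3)) σ₂ (m₂ i) (a₂ i) (b₂ i)) + s₂) 0 ^ 2 +
      (L₂ (barlowPos 1 (Real.sqrt (2 / 3)) σ₂ (m₂ i) (a₂ i) (b₂ i)) + s₂) 1 ^ 2) ≤ ρin)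
    -- fuel
    {N : ℕ} (hN₂ : ⌈(-(h + R₀) - 2 - H₂) / δ₂⌉₊ + 1 ≤ N) (hN : 8 * (h + 4 * R₀) < (N : ℝ))
    (hN₃ : 8 * (h + 4 * R₀) + 4 * (ρ + h + 2 * R₀) < 3 * (N : ℝ)) :
    (T₂.card : ℝ) ≤
      ∑ y ∈ X.filter (fun y => (X.filter fun q => dist y q = 1).card ≠ 12 ∧ -R₀ - 2 ≤ y 2 ∧ y 2 ≤ h + R₀ + 2),
        ((12 : ℝ) - ((X.filter fun q => dist y q = 1).card : ℝ)) := by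
  set e₃ : EuclideanSpace ℝ (Fin 3) := EuclideanSpace.single (2 : Fin 3) (1 : ℝ) with he₃
  have he₃n : ‖e₃‖ = 1 := by rw [he₃, PiLp.norm_single, norm_one]
  have hztn : ‖-e₃‖ = 1 := by rw [norm_neg, he₃n]
  have he₃i : ∀ d : EuclideanSpace ℝ (Fin 3), ⟪d, e₃⟫_ℝ = d 2 := fun d => by rw [he₃, EuclideanSpace.inner_single_right]; simp
  obtain ⟨hT, hinjT⟩ := topFamily_spec_apart_tilt σ₂ L₂ s₂ v₂ canon₂ ms₂ hσ₂ hX hsE hcert hσ₁ L₁ s₀ R₀ h ρ hR₀ hh hρ P₁ P₂ hP₁X hP₂X hcell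
    hP₁ hP₂ hz hze hv₂ hv₂2 hsteep₂ hcanon₂₁ hcanon₂₂ hms₂₁ hms₂₂ hδ₂0 hδ₂ hapart₂ H₂ ρin hH₂lo hH₂hi hρin₂ T₂ m₂ a₂ b₂ hlow₂ hpred₂ hinjT₂
    hlat₂ hN₂ hN
  have hzti : ∀ d : EuclideanSpace ℝ (Fin 3), ⟪d, -e₃⟫_ℝ = -d 2 := fun d => by rw [inner_neg_right, he₃i]
  have hez : ‖-e₃ - z‖ ≤ 1 / 4 := by rw [norm_sub_rev]; exact hze
  set Hz : ℝ := 2 * R₀ + (ρ + h + 2 * R₀) / 4 with hHz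
  have hnorm : ∀ q ∈ X, ‖q‖ ≤ ρ + h + 2 * R₀ := fun q hq =>
    norm_le_of_mem_cyl (by linarith) hh (by linarith) (hcell q hq)
  have hHz₂ : ∀ q ∈ X, ⟪q, z⟫_ℝ ≤ Hz := by
    intro q hq
    have h1 := inner_ref_ge_of_tilt hze q
    rw [hzti] at h1
    have h2 := (hcell q hq).1
    have h3 := hnorm q hq
    rw [hHz]; linarith
  have hfuelz : ∀ q ∈ X, 8 * (Hz - ⟪q, z⟫_ℝ) < 3 * N := by
    intro q hq
    have h1 := inner_ref_ge_of_tilt hez q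
    rw [hzti] at h1
    have h2 := (hcell q hq).2.1
    have h3 := hnorm q hq
    rw [hHz]; linarith
  set st₂ : ι₂ → EuclideanSpace ℝ (Fin 3) × List WalkEntry :=
    fun i => canon₂ (m₂ i) (L₂ (barlowPos 1 (Real.sqrt (2 / 3)) σ₂ (m₂ i) (a₂ i) (b₂ i)) + s₂) with hst₂
  -- the EMPTY second family: bottom entry `⟨L₂, 0, 0⟩` (no sound stack has it), frame set `∅`
  set st₀ : Unit → EuclideanSpace ℝ (Fin 3) × List WalkEntry := fun _ => (0, []) with hst₀
  have hH₂ : ∀ q ∈ X, ⟪q, -e₃⟫_ℝ ≤ 2 * R₀ := fun q hq => by rw [inner_neg_right, he₃i]; linarith [(hcell q hq).1]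
  have hH₀ : ∀ q ∈ X, ⟪q, e₃⟫_ℝ ≤ h + 2 * R₀ := fun q hq => by rw [he₃i]; exact (hcell q hq).2.1
  have hM₂ : ∀ stk : List WalkEntry, StackSound z stk → StackWF z stk → stk.getLast? = some ⟨L₂, v₂, 0⟩ →
      ∀ e ∈ stk, e.frame ∈ chainFrames z L₂ v₂ := fun stk hS hWF hl => frame_mem_chainFrames_of_stack hS hWF hl
  have hM₀ : ∀ stk : List WalkEntry, StackSound e₃ stk → StackWF e₃ stk → stk.getLast? = some ⟨L₂, 0, 0⟩ →
      ∀ e ∈ stk, e.frame ∈ (∅ : Set (EuclideanSpace ℝ (Fin 3) ≃ₗᵢ[ℝ] EuclideanSpace ℝ (Fin 3))) := by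
    intro stk hS _ hl
    have h0 : (0 : EuclideanSpace ℝ (Fin 3)) ∈ fccSlots := stackSound_getLast_dir_mem e₃ stk ⟨L₂, 0, 0⟩ hS hl
    have := norm_eq_one_of_mem_fccSlots h0
    rw [norm_zero] at this
    exact absurd this zero_ne_one
  have hbb : (⟨L₂, v₂, 0⟩ : WalkEntry) ≠ ⟨L₂, 0, 0⟩ := by
    intro hb
    have hv : v₂ = 0 := congrArg WalkEntry.dir hb
    have := norm_eq_one_of_mem_fccSlots hv₂
    rw [hv, norm_zero] at this
    exact zero_ne_one this
  have hsep : ∀ F₁ ∈ chainFrames z L₂ v₂, ∀ F₂ ∈ (∅ : Set (EuclideanSpace ℝ (Fin 3) ≃ₗᵢ[ℝ] EuclideanSpace ℝ (Fin 3))),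
      ¬ ∃ (L : EuclideanSpace ℝ (Fin 3) ≃ₗᵢ[ℝ] EuclideanSpace ℝ (Fin 3)) (t₁ t₂ : EuclideanSpace ℝ (Fin 3)) (σ σ' : ℤ → ℤ),
        IsHaggSeq σ ∧ IsHaggSeq σ' ∧
        F₁ '' fccStacking 1 (Real.sqrt (2 / 3)) ⊆ (fun p => L p + t₁) '' barlowStacking 1 (Real.sqrt (2 / 3)) σ ∧
        F₂ '' fccStacking 1 (Real.sqrt (2 / 3)) ⊆ (fun p => L p + t₂) '' barlowStacking 1 (Real.sqrt (2 / 3)) σ' :=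
    fun _ _ _ hF₂ => absurd hF₂ (Set.notMem_empty _)
  have h := walkerFamilies_card_le_payers_sep hX hsE hcert hDS hCP (chainFrames z L₂ v₂) ∅ hsep hz he₃n hHz₂ hH₀
    T₂ (∅ : Finset Unit) st₂ st₀ hbb N hM₂ hM₀ (fun t ht => ?_) (fun t ht => absurd ht (Finset.notMem_empty _)) hinjT
    (fun t ht => absurd ht (Finset.notMem_empty _)) _ (fun t ht => (hT t ht).2.2.2.2)
    (fun t ht => absurd ht (Finset.notMem_empty _))
  · simpa only [Finset.card_empty, Nat.cast_zero, add_zero] using h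
  · obtain ⟨hI, hW, hl, hC, -⟩ := hT t ht
    exact ⟨hI, hW, hl, hC, hfuelz _ hI.1⟩

set_option maxHeartbeats 400000 in
open scoped Classical in
/-- **The STEERED TOP plate's window lines are paid, explicit margin, clause (ii) only.** -/
theorem barlow_lineCount_le_payers_oneSided_top_tilt (hX : ∀ p ∈ X, ∀ q ∈ X, p ≠ q → 1 ≤ dist p q)
    {sE : EuclideanSpace ℝ (Fin 3)} (hsE : sE ∈ fccSlots) (hcert : ExactOnly 0 (fccSlots.filter fun w => 0 < ⟪w, sE⟫_ℝ))
    (hDS : ∀ F₁ F₂ : EuclideanSpace ℝ (Fin 3) ≃ₗᵢ[ℝ] EuclideanSpace ℝ (Fin 3), DoubleStarCoaxialAt F₁ F₂) (hCP : CapPairCoaxial)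
    -- the cell
    {σ₁ σ₂ : ℤ → ℤ} (hσ₁ : IsHaggSeq σ₁) (hσ₂ : IsHaggSeq σ₂)
    (L₁ L₂ : EuclideanSpace ℝ (Fin 3) ≃ₗᵢ[ℝ] EuclideanSpace ℝ (Fin 3)) (s₀ s₂ : EuclideanSpace ℝ (Fin 3))
    (R₀ h ρ : ℝ) (hR₀ : 6 ≤ R₀) (hh : 0 ≤ h) (hρ : 1 ≤ ρ) (P₁ P₂ : Finset (EuclideanSpace ℝ (Fin 3))) (hP₁X : P₁ ⊆ X) (hP₂X : P₂ ⊆ X)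
    (hcell : ∀ p ∈ X, -(2 * R₀) ≤ p 2 ∧ p 2 ≤ h + 2 * R₀ ∧ p 0 ^ 2 + p 1 ^ 2 ≤ ρ ^ 2)
    (hP₁ : ∀ p, p ∈ P₁ ↔ (p ∈ stacking L₁ s₀ σ₁ ∧ -(2 * R₀) ≤ p 2 ∧ p 2 ≤ -R₀ ∧ p 0 ^ 2 + p 1 ^ 2 ≤ ρ ^ 2))
    (hP₂ : ∀ p, p ∈ P₂ ↔ (p ∈ stacking L₂ s₂ σ₂ ∧ h + R₀ ≤ p 2 ∧ p 2 ≤ h + 2 * R₀ ∧ p 0 ^ 2 + p 1 ^ 2 ≤ ρ ^ 2))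
    -- the steering and the top walk data (window heights along −e₃)
    {z : EuclideanSpace ℝ (Fin 3)} (hz : ‖z‖ = 1) (hze : ‖z - (-EuclideanSpace.single (2 : Fin 3) (1 : ℝ))‖ ≤ 1 / 4)
    (v₂ : EuclideanSpace ℝ (Fin 3)) (canon₂ : ℤ → EuclideanSpace ℝ (Fin 3) → EuclideanSpace ℝ (Fin 3) × List WalkEntry)
    (ms₂ : ℤ → EuclideanSpace ℝ (Fin 3))
    (hv₂ : v₂ ∈ fccSlots) (hv₂2 : v₂ 2 = Real.sqrt (2 / 3))
    (hsteep₂ : Real.sqrt 2 / 2 ≤ ⟪L₂ v₂, z⟫_ℝ)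
    (hcanon₂₁ : ∀ m t, σ₂ (m - 1) = 1 → canon₂ m t = (t, [⟨L₂, v₂, 0⟩]))
    (hcanon₂₂ : ∀ m t, σ₂ (m - 1) = -1 → canon₂ m t =
      (t, [⟨twinFrame L₂ (L₂ (EuclideanSpace.single (2 : Fin 3) (1 : ℝ))),
            bestCapper (twinFrame L₂ (L₂ (EuclideanSpace.single (2 : Fin 3) (1 : ℝ)))) (L₂ (EuclideanSpace.single (2 : Fin 3) (1 : ℝ))) z,
            L₂ (EuclideanSpace.single (2 : Fin 3) (1 : ℝ))⟩, ⟨L₂, v₂, 0⟩]))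
    (hms₂₁ : ∀ m, σ₂ m = 1 → ms₂ m = v₂)
    (hms₂₂ : ∀ m, σ₂ m = -1 → ms₂ m =
      basalMirror (bestCapper (twinFrame L₂ (L₂ (EuclideanSpace.single (2 : Fin 3) (1 : ℝ)))) (L₂ (EuclideanSpace.single (2 : Fin 3) (1 : ℝ))) z))
    {δ₂ : ℝ} (hδ₂0 : 0 < δ₂) (hδ₂ : ∀ m, δ₂ ≤ ⟪L₂ (ms₂ m), -EuclideanSpace.single (2 : Fin 3) (1 : ℝ)⟫_ℝ)
    -- frames apart from the bottom plate (clause (ii) of `FramesApart`, for THIS family only)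
    (hapart₂ : ∀ F ∈ chainFrames z L₂ v₂,
      F '' fccStacking 1 (Real.sqrt (2 / 3)) ≠ L₁ '' fccStacking 1 (Real.sqrt (2 / 3)) ∧
      F '' fccStacking 1 (Real.sqrt (2 / 3)) ≠
        (twinFrame L₁ (L₁ (EuclideanSpace.single (2 : Fin 3) (1 : ℝ)))) '' fccStacking 1 (Real.sqrt (2 / 3)))
    -- the zigzag polyline of the top plate (axisSign = +1 for `−e₃`)
    (vertex₂ : ℤ → EuclideanSpace ℝ (Fin 3))
    (hsucc₂ : ∀ k, vertex₂ (k + 1) = vertex₂ k + ms₂ k) (hlayer₂ : ∀ k, vertex₂ k ∈ barlowLayer 1 (Real.sqrt (2 / 3)) σ₂ k) :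
    ∃ T₂ : Finset (Fin 2 → ℤ),
      (∀ t : Fin 2 → ℤ, (∃ k : ℤ,
        h + R₀ + 3 ≤ (L₂ (vertex₂ k + ((t 0 : ℝ) • triangularVec₁ 1 + (t 1 : ℝ) • triangularVec₂ 1)) + s₂) 2 ∧
        (L₂ (vertex₂ k + ((t 0 : ℝ) • triangularVec₁ 1 + (t 1 : ℝ) • triangularVec₂ 1)) + s₂) 2 ≤ h + R₀ + 4 ∧
        Real.sqrt ((L₂ (vertex₂ k + ((t 0 : ℝ) • triangularVec₁ 1 + (t 1 : ℝ) • triangularVec₂ 1)) + s₂) 0 ^ 2 +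
          (L₂ (vertex₂ k + ((t 0 : ℝ) • triangularVec₁ 1 + (t 1 : ℝ) • triangularVec₂ 1)) + s₂) 1 ^ 2) ≤
          ρ - (3 + 8 * (h + 4 * R₀) + 3 / δ₂)) → t ∈ T₂) ∧
      (T₂.card : ℝ) ≤
        ∑ y ∈ X.filter (fun y => (X.filter fun q => dist y q = 1).card ≠ 12 ∧ -R₀ - 2 ≤ y 2 ∧ y 2 ≤ h + R₀ + 2),
          ((12 : ℝ) - ((X.filter fun q => dist y q = 1).card : ℝ)) := by
  classical
  set e₃ : EuclideanSpace ℝ (Fin 3) := EuclideanSpace.single (2 : Fin 3) (1 : ℝ) with he₃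
  have he₃i : ∀ d : EuclideanSpace ℝ (Fin 3), ⟪d, e₃⟫_ℝ = d 2 := fun d => by rw [he₃, EuclideanSpace.inner_single_right]; simp
  have hzti : ∀ d : EuclideanSpace ℝ (Fin 3), ⟪d, -e₃⟫_ℝ = -d 2 := fun d => by rw [inner_neg_right, he₃i]
  set uv : (Fin 2 → ℤ) → EuclideanSpace ℝ (Fin 3) := fun t => (t 0 : ℝ) • triangularVec₁ 1 + (t 1 : ℝ) • triangularVec₂ 1 with huv
  -- constants
  have hinv0 : 0 ≤ 1 / δ₂ := by positivity
  set m : ℝ := 3 + 8 * (h + 4 * R₀) + 3 / δ₂ with hm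
  have hm0 : 0 ≤ m := by
    rw [hm]; have : 0 ≤ 3 / δ₂ := by positivity
    nlinarith
  set ρw : ℝ := ρ - m with hρw
  set ρin : ℝ := ρw + 1 / δ₂ with hρin
  have hρin₂ : ρin + 8 * (h + 4 * R₀) + ((-(h + R₀) - 2 - (-(h + R₀) - 4)) / δ₂ + 2) ≤ ρ - 1 := by
    have e : (-(h + R₀) - 2 - (-(h + R₀) - 4)) / δ₂ = 2 * (1 / δ₂) := by ring
    rw [e, hρin, hρw, hm]
    have : 3 / δ₂ = 3 * (1 / δ₂) := by ring
    nlinarith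
  -- unit steps
  have hmsn₂ : ∀ k, ‖ms₂ k‖ = 1 := by
    intro k
    rcases hσ₂ k with hk | hk
    · rw [hms₂₁ k hk, norm_eq_one_of_mem_fccSlots hv₂]
    · rw [hms₂₂ k hk, LinearIsometryEquiv.norm_map, norm_eq_one_of_mem_fccSlots (bestCapper_nabla_slot L₂ z).1]
  -- sites of the stacking
  have hsite₂ : ∀ (k : ℤ) (t : Fin 2 → ℤ), vertex₂ k + uv t ∈ barlowStacking 1 (Real.sqrt (2 / 3)) σ₂ := by
    intro k t
    obtain ⟨x, y, hxy⟩ := hlayer₂ k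
    rw [hxy, huv]; simp only
    rw [barlowPos_add_inplane]; exact barlowPos_mem _ _ _
  -- the window balls and their line set
  set W₂ : Finset (EuclideanSpace ℝ (Fin 3)) := P₂.filter fun q => h + R₀ + 3 ≤ q 2 ∧ q 2 ≤ h + R₀ + 4 ∧ Real.sqrt (q 0 ^ 2 + q 1 ^ 2) ≤ ρw
    with hW₂
  have hW₂site : ∀ q ∈ W₂, ∃ k i j : ℤ, q = L₂ (barlowPos 1 (Real.sqrt (2 / 3)) σ₂ k i j) + s₂ := by
    intro q hq
    obtain ⟨hqP, -⟩ := Finset.mem_filter.1 hq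
    obtain ⟨r, ⟨k, i, j, rfl⟩, hr⟩ := ((hP₂ q).1 hqP).1
    exact ⟨k, i, j, hr.symm⟩
  obtain ⟨Tl₂, hTl₂in, hTl₂out, -⟩ := lineSet_of_sites σ₂ L₂ s₂ vertex₂ hlayer₂ W₂ hW₂site
  -- the window family (lowest band vertices along −e₃)
  have hwin₂ : ∀ t ∈ Tl₂, ∃ k : ℤ, (-(h + R₀) - 4) ≤ ⟪L₂ (vertex₂ k + uv t) + s₂, -e₃⟫_ℝ ∧ ⟪L₂ (vertex₂ k + uv t) + s₂, -e₃⟫_ℝ ≤ (-(h + R₀) - 4) + 1 ∧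
      Real.sqrt ((L₂ (vertex₂ k + uv t) + s₂) 0 ^ 2 + (L₂ (vertex₂ k + uv t) + s₂) 1 ^ 2) ≤ ρw := by
    intro t ht
    obtain ⟨k, hk⟩ := hTl₂out t ht
    obtain ⟨-, h1, h2, h3⟩ := Finset.mem_filter.1 hk
    exact ⟨k, by rw [hzti]; linarith, by rw [hzti]; linarith, h3⟩
  obtain ⟨mi₂, ai₂, bi₂, hfam₂⟩ := lineFamily_spec σ₂ L₂ s₂ (-e₃) ms₂ vertex₂ hδ₂0 hδ₂ hmsn₂ hsucc₂ hlayer₂ (-(h + R₀) - 4) ρw Tl₂ hwin₂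
  -- fuel
  set N : ℕ := ⌈2 / δ₂⌉₊ + ⌈8 * (h + 4 * R₀)⌉₊ + ⌈4 * (ρ + h + 2 * R₀) / 3⌉₊ + 2 with hN
  have hN₂ : ⌈(-(h + R₀) - 2 - (-(h + R₀) - 4)) / δ₂⌉₊ + 1 ≤ N := by
    have e : (-(h + R₀) - 2 - (-(h + R₀) - 4)) / δ₂ = 2 / δ₂ := by ring
    rw [e, hN]; omega
  have hNfuel : 8 * (h + 4 * R₀) < (N : ℝ) := by
    rw [hN]; push_cast
    have h1 := Nat.le_ceil (8 * (h + 4 * R₀))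
    have h2 : (0 : ℝ) ≤ ⌈2 / δ₂⌉₊ := Nat.cast_nonneg _
    have h3 : (0 : ℝ) ≤ ⌈4 * (ρ + h + 2 * R₀) / 3⌉₊ := Nat.cast_nonneg _
    linarith
  have hNfuel₃ : 8 * (h + 4 * R₀) + 4 * (ρ + h + 2 * R₀) < 3 * (N : ℝ) := by
    rw [hN]; push_cast
    have h1 := Nat.le_ceil (8 * (h + 4 * R₀))
    have h1' := Nat.le_ceil (4 * (ρ + h + 2 * R₀) / 3)
    have h2 : (0 : ℝ) ≤ ⌈2 / δ₂⌉₊ := Nat.cast_nonneg _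
    have hRh : 0 ≤ h + 4 * R₀ := by linarith
    linarith
  -- the one-family count
  have hcount := barlowFamily_card_le_payers_oneSided_top_tilt hX hsE hcert hDS hCP hσ₁ hσ₂ L₁ L₂ s₀ s₂ R₀ h ρ hR₀ hh hρ P₁ P₂ hP₁X hP₂X hcell
    hP₁ hP₂ hz hze v₂ canon₂ ms₂ hv₂ hv₂2 hsteep₂ hcanon₂₁ hcanon₂₂ hms₂₁ hms₂₂ hδ₂0 hδ₂ hapart₂ (-(h + R₀) - 4) ρin (by linarith) (by linarith)
    hρin₂ Tl₂ mi₂ ai₂ bi₂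
    (fun t ht => (hfam₂ t ht).2.1) (fun t ht => (hfam₂ t ht).2.2.2.1) (fun t ht t' ht' heq => (hfam₂ t ht).2.2.2.2.2 t' ht' heq)
    (fun t ht => by have := (hfam₂ t ht).2.2.2.2.1; rw [hρin]; linarith)
    hN₂ hNfuel hNfuel₃
  refine ⟨Tl₂, fun t ht => ?_, hcount⟩
  obtain ⟨k, h1', h2', h3'⟩ := ht
  have h1 : h + R₀ + 3 ≤ (L₂ (vertex₂ k + uv t) + s₂) 2 := h1'
  have h2 : (L₂ (vertex₂ k + uv t) + s₂) 2 ≤ h + R₀ + 4 := h2'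
  have h3 : Real.sqrt ((L₂ (vertex₂ k + uv t) + s₂) 0 ^ 2 + (L₂ (vertex₂ k + uv t) + s₂) 1 ^ 2) ≤ ρ - m := h3'
  have h0 : 0 ≤ (L₂ (vertex₂ k + uv t) + s₂) 0 ^ 2 + (L₂ (vertex₂ k + uv t) + s₂) 1 ^ 2 := by positivity
  have hs := Real.sqrt_nonneg ((L₂ (vertex₂ k + uv t) + s₂) 0 ^ 2 + (L₂ (vertex₂ k + uv t) + s₂) 1 ^ 2)
  have hle : Real.sqrt ((L₂ (vertex₂ k + uv t) + s₂) 0 ^ 2 + (L₂ (vertex₂ k + uv t) + s₂) 1 ^ 2) ≤ ρ := by linarith only [h3, hm0]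
  have hlat2 : (L₂ (vertex₂ k + uv t) + s₂) 0 ^ 2 + (L₂ (vertex₂ k + uv t) + s₂) 1 ^ 2 ≤ ρ ^ 2 := by
    have h7 := pow_le_pow_left₀ hs hle 2
    rwa [Real.sq_sqrt h0] at h7
  have hstk : L₂ (vertex₂ k + uv t) + s₂ ∈ stacking L₂ s₂ σ₂ := by
    unfold stacking; exact Set.mem_image_of_mem (fun r => L₂ r + s₂) (hsite₂ k t)
  have hqP : L₂ (vertex₂ k + uv t) + s₂ ∈ P₂ := (hP₂ _).2 ⟨hstk, by linarith only [h1], by linarith only [h2, hR₀], hlat2⟩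
  have hqW : L₂ (vertex₂ k + uv t) + s₂ ∈ W₂ := by
    rw [hW₂, Finset.mem_filter]; exact ⟨hqP, h1, h2, by rw [hρw]; exact h3⟩
  exact hTl₂in t ⟨k, hqW⟩


end Summit.Ventures.Crystal3D.Theorems

end
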